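import Literature.Analysis.Distribution.FourierSupportAtZero
import HarnessLib

/-!
# A bounded function whose Fourier transform is supported at the origin is constant, II: the theorem

Topic `Literature/Analysis/Distribution`, sibling of `FourierSupportAtZero` (tools: plateau
functions `Θ_R`, their Fourier scaling, the translation invariance of the hypothesis, continuity of
translation in `L¹`). Here the theorem (`eq_of_forall_integral_fourier_mul_eq_zero`): for a bounded
continuous `t : V → ℂ` on a finite-dimensional real inner product space with
`∫ 𝓕h(a) t(a) da = 0` for every Schwartz `h` vanishing near `0` — "the Fourier transform of `t` is
supported at the origin" — `t` is constant. Proof: `∫ 𝓕Θ_R · t` does not depend on `R` and tends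
to `t(0)` as `R → ∞`, so equals `t(0)` for every `R > 0` (`integral_fourier_plateauSchwartz_mul_eq`);
applied to the translates of `t`, `t(c) − t(c') = ∫ (𝓕Θ_R(v − c) − 𝓕Θ_R(v − c')) t(v) dv`, which is
`O(∫ |𝓕Θ₁(w + R(c − c')) − 𝓕Θ₁(w)| dw) → 0` as `R → 0⁺`. This is the bounded case of the
structure theorem for point-supported distributions (Hörmander Thm. 2.3.4: such a distribution is a
polynomial), the mechanism of "(4-79) must be a multiple of `Ψ₀`" in Streater–Wightman's proof of
the Jost–Schroer theorem (§4-5): a vector of a unitary representation of the translations with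
spectral support `{0}` is invariant.

## References

* L. Hörmander, *The Analysis of Linear Partial Differential Operators I*, Thm. 2.3.4.
  [HormanderALPDO1]
* R. F. Streater, A. S. Wightman, *PCT, Spin and Statistics, and All That*, §4-5, proof of
  Thm 4-15, (4-79)–(4-80). [StreaterWightman2001]
-/

noncomputable section

open MeasureTheory Filter FourierTransform Real Complex
open scoped Topology SchwartzMap InnerProductSpace ContDiff

namespace Literature.Analysis.Distribution

variable {V : Type*} [NormedAddCommGroup V] [InnerProductSpace ℝ V] [FiniteDimensional ℝ V]
  [MeasurableSpace V] [BorelSpace V]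

/-! ### The theorem -/

section Main

variable {t : V → ℂ} {C : ℝ}

/-- For every `R > 0`, `∫ 𝓕Θ_R · t = t(0)`: the left side does not depend on `R` (the differences
`Θ_R − Θ_R'` vanish near `0`) and tends to `t(0)` as `R → ∞`. [folklore] -/
theorem integral_fourier_plateauSchwartz_mul_eq (ht : Continuous t) (hC : ∀ a, ‖t a‖ ≤ C)
    (h0 : ∀ h : 𝓢(V, ℂ), (0 : V) ∉ tsupport (h : V → ℂ) →
      ∫ a, (𝓕 h : 𝓢(V, ℂ)) a * t a = 0)
    {R : ℝ} (hR : 0 < R) :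
    ∫ a, (𝓕 (plateauSchwartz (V := V) hR) : 𝓢(V, ℂ)) a * t a = t 0 := by
  set Θ₁ : 𝓢(V, ℂ) := plateauSchwartz (V := V) one_pos with hΘ₁
  set n : ℕ := Module.finrank ℝ V with hn
  -- independence of `R`
  have hind : ∀ {R R' : ℝ} (hR : 0 < R) (hR' : 0 < R'),
      ∫ a, (𝓕 (plateauSchwartz (V := V) hR) : 𝓢(V, ℂ)) a * t a =
        ∫ a, (𝓕 (plateauSchwartz (V := V) hR') : 𝓢(V, ℂ)) a * t a := by
    intro R R' hR hR'
    have h := h0 _ (zero_notMem_tsupport_plateauSchwartz_sub (V := V) hR hR')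
    rw [integral_fourier_sub_mul ht hC] at h
    exact sub_eq_zero.1 h
  -- rescaling: `∫ 𝓕Θ_R · t = ∫ 𝓕Θ₁(v) t(v/R) dv`
  have hscale : ∀ {R' : ℝ} (hR' : 0 < R'),
      ∫ a, (𝓕 (plateauSchwartz (V := V) hR') : 𝓢(V, ℂ)) a * t a =
        ∫ v, (𝓕 Θ₁ : 𝓢(V, ℂ)) v * t (R'⁻¹ • v) := by
    intro R' hR'
    simp_rw [fourier_plateauSchwartz_apply hR']
    have h1 : (fun a => (R' ^ n : ℝ) • (𝓕 Θ₁ : 𝓢(V, ℂ)) (R' • a) * t a) =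
        fun a => (fun v => (R' ^ n : ℝ) • ((𝓕 Θ₁ : 𝓢(V, ℂ)) v * t (R'⁻¹ • v))) (R' • a) := by
      funext a
      simp only [smul_smul, inv_mul_cancel₀ hR'.ne', one_smul, smul_mul_assoc]
    rw [h1, Measure.integral_comp_smul_of_nonneg volume
        (fun v => (R' ^ n : ℝ) • ((𝓕 Θ₁ : 𝓢(V, ℂ)) v * t (R'⁻¹ • v))) R' (hR := hR'.le),
      integral_smul, smul_smul, inv_mul_cancel₀ (pow_ne_zero _ hR'.ne'), one_smul]
  -- the limit `R → ∞`
  have hlim : Tendsto (fun R' : ℝ => ∫ v, (𝓕 Θ₁ : 𝓢(V, ℂ)) v * t (R'⁻¹ • v)) atTop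
      (𝓝 (∫ v, (𝓕 Θ₁ : 𝓢(V, ℂ)) v * t 0)) := by
    refine tendsto_integral_filter_of_dominated_convergence (fun v => ‖(𝓕 Θ₁ : 𝓢(V, ℂ)) v‖ * C)
      ?_ ?_ ((𝓕 Θ₁ : 𝓢(V, ℂ)).integrable.norm.mul_const C) ?_
    · exact Eventually.of_forall fun R' =>
        ((𝓕 Θ₁ : 𝓢(V, ℂ)).continuous.mul (ht.comp (continuous_const.smul continuous_id)))
          |>.aestronglyMeasurable
    · exact Eventually.of_forall fun R' => Eventually.of_forall fun v => by
        rw [norm_mul]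
        exact mul_le_mul_of_nonneg_left (hC _) (norm_nonneg _)
    · refine Eventually.of_forall fun v => (tendsto_const_nhds.mul ?_)
      have h1 : Tendsto (fun R' : ℝ => R'⁻¹ • v) atTop (𝓝 ((0 : ℝ) • v)) :=
        tendsto_inv_atTop_zero.smul_const v
      rw [zero_smul] at h1
      exact ht.continuousAt.tendsto.comp h1
  have hval : ∫ v, (𝓕 Θ₁ : 𝓢(V, ℂ)) v * t 0 = t 0 := by
    rw [integral_mul_const, integral_fourier_plateauSchwartz_one, one_mul]
  -- the sequence is eventually constant, equal to the `R`-integral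
  have hconst : (fun R' : ℝ => ∫ v, (𝓕 Θ₁ : 𝓢(V, ℂ)) v * t (R'⁻¹ • v)) =ᶠ[atTop]
      fun _ => ∫ a, (𝓕 (plateauSchwartz (V := V) hR) : 𝓢(V, ℂ)) a * t a := by
    filter_upwards [eventually_gt_atTop 0] with R' hR'
    rw [← hscale hR', hind hR' hR]
  rw [← hval]
  exact (tendsto_nhds_unique (hlim.congr' hconst) tendsto_const_nhds).symm

/-- **A bounded continuous function whose Fourier transform is supported at the origin is
constant.** If `t : V → ℂ` is continuous and bounded and `∫ 𝓕h(a) t(a) da = 0` for every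
Schwartz `h` vanishing near `0`, then `t(c) = t(c')` for all `c, c'` (the bounded case of: a
tempered distribution with Fourier transform supported at `{0}` is a polynomial, Hörmander
Thm. 2.3.4; used for "(4-79) must be a multiple of `Ψ₀`", Streater–Wightman §4-5). [folklore] -/
theorem eq_of_forall_integral_fourier_mul_eq_zero (ht : Continuous t) (hC : ∀ a, ‖t a‖ ≤ C)
    (h0 : ∀ h : 𝓢(V, ℂ), (0 : V) ∉ tsupport (h : V → ℂ) →
      ∫ a, (𝓕 h : 𝓢(V, ℂ)) a * t a = 0)
    (c c' : V) : t c = t c' := by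
  set Θ₁ : 𝓢(V, ℂ) := plateauSchwartz (V := V) one_pos with hΘ₁
  set n : ℕ := Module.finrank ℝ V with hn
  -- `t(c) = ∫ 𝓕Θ_R(v − c) t(v) dv` for every `R > 0` and every `c`
  have hrep : ∀ (c : V) {R : ℝ} (hR : 0 < R),
      t c = ∫ v, (𝓕 (plateauSchwartz (V := V) hR) : 𝓢(V, ℂ)) (v - c) * t v := by
    intro c R hR
    have htc : Continuous fun a => t (a + c) := ht.comp (continuous_id.add continuous_const)
    have h := integral_fourier_plateauSchwartz_mul_eq htc (fun a => hC (a + c))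
      (integral_fourier_mul_translate_eq_zero h0 c) hR
    rw [zero_add] at h
    rw [← h, ← integral_add_right_eq_self
      (fun v => (𝓕 (plateauSchwartz (V := V) hR) : 𝓢(V, ℂ)) (v - c) * t v) c]
    simp only [add_sub_cancel_right]
  -- the difference, rescaled: `‖t c − t c'‖ ≤ C ∫ ‖𝓕Θ₁(w + R(c − c')) − 𝓕Θ₁(w)‖ dw`
  have hdiff : ∀ {R : ℝ} (hR : 0 < R),
      ‖t c - t c'‖ ≤ C * ∫ w, ‖(𝓕 Θ₁ : 𝓢(V, ℂ)) (w + R • (c - c')) - (𝓕 Θ₁ : 𝓢(V, ℂ)) w‖ := by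
    intro R hR
    set Θ : 𝓢(V, ℂ) := plateauSchwartz (V := V) hR with hΘ
    have hI : ∀ c : V, Integrable fun v => (𝓕 Θ : 𝓢(V, ℂ)) (v - c) * t v := by
      intro c
      refine ((((𝓕 Θ : 𝓢(V, ℂ)).integrable.comp_sub_right c).norm.mul_const C).mono' ?_
        (Eventually.of_forall fun v => ?_))
      · exact (((𝓕 Θ : 𝓢(V, ℂ)).continuous.comp (continuous_id.sub continuous_const)).mul ht)
          |>.aestronglyMeasurable
      · rw [norm_mul]
        exact mul_le_mul_of_nonneg_left (hC v) (norm_nonneg _)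
    rw [hrep c hR, hrep c' hR, ← integral_sub (hI c) (hI c')]
    calc ‖∫ v, ((𝓕 Θ : 𝓢(V, ℂ)) (v - c) * t v - (𝓕 Θ : 𝓢(V, ℂ)) (v - c') * t v)‖
        ≤ ∫ v, ‖(𝓕 Θ : 𝓢(V, ℂ)) (v - c) * t v - (𝓕 Θ : 𝓢(V, ℂ)) (v - c') * t v‖ :=
          norm_integral_le_integral_norm _
      _ ≤ ∫ v, ‖(𝓕 Θ : 𝓢(V, ℂ)) (v - c) - (𝓕 Θ : 𝓢(V, ℂ)) (v - c')‖ * C := by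
          refine integral_mono_of_nonneg (Eventually.of_forall fun v => norm_nonneg _) ?_
            (Eventually.of_forall fun v => ?_)
          · exact (((𝓕 Θ : 𝓢(V, ℂ)).integrable.comp_sub_right c).sub
              ((𝓕 Θ : 𝓢(V, ℂ)).integrable.comp_sub_right c')).norm.mul_const C
          · dsimp only
            rw [← sub_mul, norm_mul]
            exact mul_le_mul_of_nonneg_left (hC v) (norm_nonneg _)
      _ = C * ∫ v, ‖(𝓕 Θ : 𝓢(V, ℂ)) (v - c) - (𝓕 Θ : 𝓢(V, ℂ)) (v - c')‖ := by
          rw [integral_mul_const, mul_comm]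
      _ = C * ∫ w, ‖(𝓕 Θ₁ : 𝓢(V, ℂ)) (w + R • (c - c')) - (𝓕 Θ₁ : 𝓢(V, ℂ)) w‖ := by
          simp_rw [hΘ, fourier_plateauSchwartz_apply hR]
          rw [integral_norm_scaled_translate_sub]
          exact hR
  -- let `R → 0⁺`
  have hlim : Tendsto (fun R : ℝ => C * ∫ w, ‖(𝓕 Θ₁ : 𝓢(V, ℂ)) (w + R • (c - c')) -
      (𝓕 Θ₁ : 𝓢(V, ℂ)) w‖) (𝓝[>] 0) (𝓝 (C * 0)) := by
    refine Tendsto.const_mul C ?_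
    have h1 : Tendsto (fun R : ℝ => R • (c - c')) (𝓝[>] 0) (𝓝 0) := by
      have : Tendsto (fun R : ℝ => R • (c - c')) (𝓝 0) (𝓝 ((0 : ℝ) • (c - c'))) :=
        tendsto_id.smul_const _
      rw [zero_smul] at this
      exact this.mono_left nhdsWithin_le_nhds
    exact (tendsto_integral_norm_translate_sub (𝓕 Θ₁ : 𝓢(V, ℂ))).comp h1
  rw [mul_zero] at hlim
  have hle : ‖t c - t c'‖ ≤ 0 :=
    ge_of_tendsto hlim (by
      filter_upwards [self_mem_nhdsWithin] with R hR
      exact hdiff hR)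
  exact sub_eq_zero.1 (norm_le_zero_iff.1 hle)

end Main

end Literature.Analysis.Distribution
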